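import Literature.AlgebraicGeometry.Motives.MixedHodgeStructureSemisimpleMultiplicity
import Literature.AlgebraicGeometry.Motives.MixedHodgeStructureSocleHodgeClasses
import HarnessLib

/-!
# Hodge classes and the multiplicity of `ℚ(-p)`: `dim Hdgᵖ(H) = [soc H : ℚ(-p)] ≤ [H : ℚ(-p)]`

Sequel to `MixedHodgeStructureTateHomHodgeClasses` (`Hdgᵖ(H) = Hom_MHS(ℚ(-p), H)`, Arapura's `Hodge(H(p)) =
Hom_MHS(ℚ(0), H(p))`), `MixedHodgeStructureSocleHodgeClasses` (`Hdgᵖ(H) ⊆ soc H`, `Hdgᵖ(H) = Hdgᵖ(soc H)`) and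
`MixedHodgeStructureSemisimpleMultiplicity` (constituents of a semisimple MHS). Jannsen, *Mixed Motives and
Algebraic K-Theory*, 7.8 (p. 94): the Hodge-class functor `Γ = Hom(1, −)` "is not exact", but behaves well on
semi-simple objects (7.8 b)). This file makes the defect quantitative through the Jordan–Hölder multiplicity
`[H : ℚ(-p)]` of the simple Tate object `ℚ(-p)` (Beachy, §2.5; Cattani et al., Thm. 3.2.18):

* §1 the `ℚ`-span of the images of all morphisms `ℚ(-p) → H` is `Hdgᵖ(H)` (`iSup_range_tateHom_eq_hodgeClasses`);
  for a simple `H`, `Hdgᵖ(H) = 0` unless `H ≅ ℚ(-p)`, and **`dim Hdgᵖ(H) = [H : ℚ(-p)]`** (`= 1` or `0`).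
* §2 `dim Hdgᵖ` is additive on direct sums of sub-MHS, and **for a SEMISIMPLE `H`: `dim_ℚ Hdgᵖ(H) = [H : ℚ(-p)]`**
  (`IsSemisimple.finrank_hodgeClasses_eq_multiplicity`) — Jannsen's 7.8 b) in numerical form.
* §3 for an ARBITRARY `H`: **`dim_ℚ Hdgᵖ(H) = [soc H : ℚ(-p)] ≤ [H : ℚ(-p)] = [Gr^W_{2p} H : ℚ(-p)]`**, with
  defect `[H : ℚ(-p)] − dim Hdgᵖ(H) = [H / soc H : ℚ(-p)]` (the composition factors `ℚ(-p)` of `H` that are not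
  split off in the socle carry no Hodge class — non-exactness of `Γ`); equality iff `[H/soc H : ℚ(-p)] = 0`, in
  particular for `ℚ`-split graded-polarizable MHS and for polarizable pure Hodge structures; for graded-polarizable
  `H`, `[H : ℚ(-p)] = dim Hdgᵖ(Gr^W_{2p} H)`.

All statements proved; no definitions, no named facts, no instances.

## References

* [Jannsen1990MixedMotives] U. Jannsen, Mixed Motives and Algebraic K-Theory, LNM 1400 (1990), 7.8 a), b) (p. 94).
* [Arapura2022] D. Arapura, Hodge cycles and the Leray filtration, Pacific J. Math. 319 (2022), §1 (p. 3), Lemma 1.1.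
* [Beachy1999RingsModules] J. A. Beachy, Introductory Lectures on Rings and Modules (1999), §2.5, Def. 2.5.1, Thm. 2.5.2.
* [CattaniElZeinGriffithsLe2014] E. Cattani et al. (eds.), Hodge Theory (2014), Thm. 3.2.18, p. 270, Ch. 12 fn. 2 (p. 527).
-/

noncomputable section

namespace Literature.AlgebraicGeometry.Motives

namespace MixedHodgeStructure

open Module SubMixedHodgeStructure

universe u

section IsoHelpers

variable {W₁ : Type*} [AddCommGroup W₁] [Module ℚ W₁] {G₁ : MixedHodgeStructure W₁}
variable {W₂ : Type*} [AddCommGroup W₂] [Module ℚ W₂] {G₂ : MixedHodgeStructure W₂}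

/-- "Isomorphic" is symmetric. [cite: CattaniElZeinGriffithsLe2014, Thm. 3.2.18] -/
private theorem iso_symm (h : ∃ e : Hom G₁ G₂, Function.Bijective e.toLinearMap) :
    ∃ e : Hom G₂ G₁, Function.Bijective e.toLinearMap := by
  obtain ⟨e, he⟩ := h
  refine ⟨e.inverse he, ?_⟩
  rw [Hom.inverse_toLinearMap]
  exact (LinearEquiv.ofBijective e.toLinearMap he).symm.bijective

end IsoHelpers

variable {V : Type u} [AddCommGroup V] [Module ℚ V] {H : MixedHodgeStructure V}

/-- A morphism `ℚ(-p) → H` is `q ↦ q • f(1)`. [cite: Arapura2022, §1 (p. 3)] -/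
private theorem tate_apply_eq_smul {p : ℤ} (f : Hom (HodgeStructure.tate (-p)).toMixedHodgeStructure H) (q : ℚ) :
    f.toLinearMap q = q • f.toLinearMap 1 := by
  rw [← map_smul, smul_eq_mul, mul_one]

/-! ### §1 Hodge classes as images of `ℚ(-p)`; the simple case -/

/-- **The `ℚ`-span of the images of all morphisms `ℚ(-p) → H` is `Hdgᵖ(H)`** (`Hdgᵖ(H) = Hom_MHS(ℚ(-p), H)` via
`f ↦ f(1)`). [cite: Arapura2022, §1 (p. 3)] [cite: Jannsen1990MixedMotives, 7.8 (p. 94)] -/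
theorem iSup_range_tateHom_eq_hodgeClasses (H : MixedHodgeStructure V) (p : ℤ) :
    (⨆ f : Hom (HodgeStructure.tate (-p)).toMixedHodgeStructure H, LinearMap.range f.toLinearMap) = H.hodgeClasses p := by
  refine le_antisymm (iSup_le fun f => ?_) fun v hv => ?_
  · rintro _ ⟨q, rfl⟩
    rw [tate_apply_eq_smul]
    exact Submodule.smul_mem _ q (f.apply_one_mem_hodgeClasses p)
  · refine Submodule.mem_iSup_of_mem (Hom.ofHodgeClass H p ⟨v, hv⟩) ⟨1, ?_⟩
    rw [Hom.ofHodgeClass_toLinearMap_apply, one_smul]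

/-- **A simple MHS has no Hodge class of type `(p,p)` unless it is `≅ ℚ(-p)`** (a non-zero Hodge class is a
non-zero morphism `ℚ(-p) → H`, an isomorphism by Schur). [cite: Arapura2022, §1 (p. 3)] [cite: CattaniElZeinGriffithsLe2014, p. 270] -/
theorem IsSimple.hodgeClasses_eq_bot_or_exists_iso (h : H.IsSimple) (p : ℤ) :
    H.hodgeClasses p = ⊥ ∨
      ∃ e : Hom (HodgeStructure.tate (-p)).toMixedHodgeStructure H, Function.Bijective e.toLinearMap := by
  by_cases hb : H.hodgeClasses p = ⊥
  · exact Or.inl hb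
  · right
    obtain ⟨v, hv, hv0⟩ := Submodule.exists_mem_ne_zero_of_ne_bot hb
    refine ⟨Hom.ofHodgeClass H p ⟨v, hv⟩, (isSimple_tate (-p)).bijective_of_ne_zero h ?_⟩
    rw [Ne, Hom.tate_eq_zero_iff, Hom.ofHodgeClass_toLinearMap_apply, one_smul]
    exact hv0

/-- A MHS isomorphic to `ℚ(-p)` via `e` has the non-zero Hodge class `e(1)`. [cite: Arapura2022, §1 (p. 3)] -/
theorem hodgeClasses_ne_bot_of_iso {p : ℤ} (e : Hom (HodgeStructure.tate (-p)).toMixedHodgeStructure H)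
    (he : Function.Injective e.toLinearMap) : H.hodgeClasses p ≠ ⊥ := fun hb => by
  have h1 := e.apply_one_mem_hodgeClasses p
  rw [hb, Submodule.mem_bot] at h1
  exact one_ne_zero (he (by rw [h1, map_zero]))

open scoped Classical in
/-- **For a simple `H`: `dim Hdgᵖ(H) = [H : ℚ(-p)]`** (`= 1` if `H ≅ ℚ(-p)`, else `0`). [cite: Arapura2022, §1 (p. 3)]
[cite: Beachy1999RingsModules, §2.5, Def. 2.5.1] -/
theorem IsSimple.finrank_hodgeClasses_eq_multiplicity [FiniteDimensional ℚ V] (h : H.IsSimple) (p : ℤ) :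
    finrank ℚ (H.hodgeClasses p) = H.multiplicity (HodgeStructure.tate (-p)).toMixedHodgeStructure := by
  rw [h.multiplicity_eq]
  rcases h.hodgeClasses_eq_bot_or_exists_iso p with hb | ⟨e, he⟩
  · rw [hb, finrank_bot, if_neg]
    intro hiso
    obtain ⟨e, he⟩ := iso_symm hiso
    exact hodgeClasses_ne_bot_of_iso e he.1 hb
  · rw [if_pos (iso_symm ⟨e, he⟩)]
    have hV : finrank ℚ V = 1 := by
      rw [← (LinearEquiv.ofBijective e.toLinearMap he).finrank_eq, Module.finrank_self]
    refine le_antisymm ((Submodule.finrank_le _).trans hV.le) ?_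
    rw [Nat.one_le_iff_ne_zero, Ne, Submodule.finrank_eq_zero]
    exact hodgeClasses_ne_bot_of_iso e he.1

/-! ### §2 Additivity on direct sums; the semisimple case -/

/-- **`dim Hdgᵖ(S ⊕ T) = dim Hdgᵖ(S) + dim Hdgᵖ(T)`** for complementary sub-MHS. [cite: Jannsen1990MixedMotives, 7.8 a) (p. 94)]
[cite: Arapura2022, §1 (p. 3)] -/
theorem finrank_hodgeClasses_eq_add_of_isCompl [FiniteDimensional ℚ V] (S T : SubMixedHodgeStructure H)
    (hST : IsCompl S.toSubmodule T.toSubmodule) (p : ℤ) :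
    finrank ℚ (H.hodgeClasses p) =
      finrank ℚ (S.toMixedHodgeStructure.hodgeClasses p) + finrank ℚ (T.toMixedHodgeStructure.hodgeClasses p) := by
  have hS : finrank ℚ (S.toMixedHodgeStructure.hodgeClasses p) = finrank ℚ ↥(H.hodgeClasses p ⊓ S.toSubmodule) := by
    rw [← S.map_subtype_hodgeClasses p]
    exact LinearEquiv.finrank_eq (Submodule.equivMapOfInjective _ (Submodule.injective_subtype S.toSubmodule) _)
  have hT : finrank ℚ (T.toMixedHodgeStructure.hodgeClasses p) = finrank ℚ ↥(H.hodgeClasses p ⊓ T.toSubmodule) := by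
    rw [← T.map_subtype_hodgeClasses p]
    exact LinearEquiv.finrank_eq (Submodule.equivMapOfInjective _ (Submodule.injective_subtype T.toSubmodule) _)
  have hdisj : Disjoint (H.hodgeClasses p ⊓ S.toSubmodule) (H.hodgeClasses p ⊓ T.toSubmodule) :=
    hST.disjoint.mono inf_le_right inf_le_right
  have hsup := Submodule.finrank_sup_add_finrank_inf_eq (H.hodgeClasses p ⊓ S.toSubmodule)
    (H.hodgeClasses p ⊓ T.toSubmodule)
  rw [hdisj.eq_bot, finrank_bot, add_zero, ← hodgeClasses_eq_sup_of_isCompl S T hST p] at hsup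
  rw [hS, hT, hsup]

/-- The auxiliary induction on `dim V` for `IsSemisimple.finrank_hodgeClasses_eq_multiplicity`.
[cite: Jannsen1990MixedMotives, 7.8 b) (p. 94)] -/
private theorem finrank_hodgeClasses_aux (p : ℤ) (d : ℕ) : ∀ {W : Type u} [AddCommGroup W] [Module ℚ W]
    [FiniteDimensional ℚ W] (K : MixedHodgeStructure W), finrank ℚ W ≤ d → K.IsSemisimple →
    finrank ℚ (K.hodgeClasses p) = K.multiplicity (HodgeStructure.tate (-p)).toMixedHodgeStructure := by
  induction d with
  | zero =>
    intro W _ _ _ K hd _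
    haveI : Subsingleton W := finrank_zero_iff.1 (Nat.le_zero.1 hd)
    rw [multiplicity_eq_zero_of_subsingleton]
    exact Nat.le_zero.1 ((Submodule.finrank_le _).trans (Nat.le_zero.1 hd).le)
  | succ d ih =>
    intro W _ _ _ K hd hK
    by_cases hW : Subsingleton W
    · exact ih K (by rw [finrank_zero_of_subsingleton]; exact Nat.zero_le _) hK
    rw [not_subsingleton_iff_nontrivial] at hW
    obtain ⟨S₀, hS₀⟩ := K.exists_subMixedHodgeStructure_isSimple
    obtain ⟨T, hT⟩ := hK S₀
    haveI := hS₀.nontrivial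
    have hdim : finrank ℚ T.toSubmodule ≤ d := by
      have h1 := Submodule.finrank_add_eq_of_isCompl hT
      have h2 : 0 < finrank ℚ S₀.toSubmodule := finrank_pos
      omega
    rw [finrank_hodgeClasses_eq_add_of_isCompl S₀ T hT p, multiplicity_eq_add_of_isCompl S₀ T hT,
      hS₀.finrank_hodgeClasses_eq_multiplicity p, ih T.toMixedHodgeStructure hdim (hK.subMixedHodgeStructure T)]

/-- **For a SEMISIMPLE mixed Hodge structure, `dim_ℚ Hdgᵖ(H) = [H : ℚ(-p)]`**: the rank of the Hodge classes of
type `(p,p)` is the multiplicity of `ℚ(-p)` as a composition factor (Jannsen 7.8 b): the Hodge-class functor is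
exact on semi-simple objects). [cite: Jannsen1990MixedMotives, 7.8 b) (p. 94)] [cite: Arapura2022, §1 (p. 3)]
[cite: Beachy1999RingsModules, §2.5, Thm. 2.5.2] -/
theorem IsSemisimple.finrank_hodgeClasses_eq_multiplicity [FiniteDimensional ℚ V] (hH : H.IsSemisimple) (p : ℤ) :
    finrank ℚ (H.hodgeClasses p) = H.multiplicity (HodgeStructure.tate (-p)).toMixedHodgeStructure :=
  finrank_hodgeClasses_aux p (finrank ℚ V) H le_rfl hH

/-! ### §3 Arbitrary `H`: `dim Hdgᵖ(H) = [soc H : ℚ(-p)] ≤ [H : ℚ(-p)]` -/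

variable [FiniteDimensional ℚ V]

variable (H) in
/-- **`dim_ℚ Hdgᵖ(H) = [soc H : ℚ(-p)]`** for every MHS `H` (the Hodge classes live in the semisimple socle).
[cite: Jannsen1990MixedMotives, 7.8 (p. 94)] [cite: CattaniElZeinGriffithsLe2014, Thm. 3.2.18 and p. 270] -/
theorem finrank_hodgeClasses_eq_multiplicity_socle (p : ℤ) :
    finrank ℚ (H.hodgeClasses p) = (socle H).toMixedHodgeStructure.multiplicity (HodgeStructure.tate (-p)).toMixedHodgeStructure := by
  rw [← finrank_hodgeClasses_socle H p]
  exact (isSemisimple_socle H).finrank_hodgeClasses_eq_multiplicity p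

variable (H) in
/-- **`dim_ℚ Hdgᵖ(H) ≤ [H : ℚ(-p)]`**: there are at most as many independent Hodge classes of type `(p,p)` as
composition factors `ℚ(-p)`. [cite: Jannsen1990MixedMotives, 7.8 (p. 94)] [cite: Beachy1999RingsModules, §2.5, Thm. 2.5.2] -/
theorem finrank_hodgeClasses_le_multiplicity (p : ℤ) :
    finrank ℚ (H.hodgeClasses p) ≤ H.multiplicity (HodgeStructure.tate (-p)).toMixedHodgeStructure := by
  rw [finrank_hodgeClasses_eq_multiplicity_socle H p]
  exact (socle H).multiplicity_toMixedHodgeStructure_le _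

variable (H) in
/-- **The defect is `[H/soc H : ℚ(-p)]`**: `dim Hdgᵖ(H) + [H/soc H : ℚ(-p)] = [H : ℚ(-p)]` — the composition factors
`ℚ(-p)` above the socle carry no Hodge class (non-exactness of `Γ = Hom(ℚ(0), −)`).
[cite: Jannsen1990MixedMotives, 7.8 (p. 94)] [cite: Beachy1999RingsModules, §2.5, Thm. 2.5.2] -/
theorem finrank_hodgeClasses_add_multiplicity_quotient_socle (p : ℤ) :
    finrank ℚ (H.hodgeClasses p) + (socle H).quotient.multiplicity (HodgeStructure.tate (-p)).toMixedHodgeStructure =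
      H.multiplicity (HodgeStructure.tate (-p)).toMixedHodgeStructure := by
  rw [finrank_hodgeClasses_eq_multiplicity_socle H p]
  exact (socle H).multiplicity_add _

variable (H) in
/-- `dim Hdgᵖ(H) = [H : ℚ(-p)]` iff `ℚ(-p)` is not a composition factor of `H / soc H`. [cite: Jannsen1990MixedMotives, 7.8 (p. 94)] -/
theorem finrank_hodgeClasses_eq_multiplicity_iff (p : ℤ) :
    finrank ℚ (H.hodgeClasses p) = H.multiplicity (HodgeStructure.tate (-p)).toMixedHodgeStructure ↔
      (socle H).quotient.multiplicity (HodgeStructure.tate (-p)).toMixedHodgeStructure = 0 := by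
  have h := finrank_hodgeClasses_add_multiplicity_quotient_socle H p
  omega

/-- For a `ℚ`-split graded-polarizable (= semisimple graded-polarizable) MHS: `dim Hdgᵖ(H) = [H : ℚ(-p)]`.
[cite: Jannsen1990MixedMotives, 7.8 b) (p. 94)] [cite: CattaniElZeinGriffithsLe2014, Ch. 12 footnote 2 (p. 527)] -/
theorem IsSplitOverQ.finrank_hodgeClasses_eq_multiplicity (hs : H.IsSplitOverQ) (hp : H.IsGradedPolarizable) (p : ℤ) :
    finrank ℚ (H.hodgeClasses p) = H.multiplicity (HodgeStructure.tate (-p)).toMixedHodgeStructure :=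
  (hs.isSemisimple hp).finrank_hodgeClasses_eq_multiplicity p

/-- For a polarizable pure Hodge structure: `dim Hdgᵖ(H) = [H : ℚ(-p)]`. [cite: Jannsen1990MixedMotives, 7.8 b) and Thm. 7.9 (proof)] -/
theorem _root_.Literature.AlgebraicGeometry.Motives.HodgeStructure.IsPolarizable.finrank_hodgeClasses_eq_multiplicity
    {n : ℤ} {H₀ : HodgeStructure V n} (hH₀ : H₀.IsPolarizable) (p : ℤ) :
    finrank ℚ (H₀.toMixedHodgeStructure.hodgeClasses p) =
      H₀.toMixedHodgeStructure.multiplicity (HodgeStructure.tate (-p)).toMixedHodgeStructure :=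
  hH₀.isSemisimple_toMixedHodgeStructure.finrank_hodgeClasses_eq_multiplicity p

variable (H) in
/-- `ℚ(-p)` is pure of weight `2p`, so **`[H : ℚ(-p)] = [Gr^W_{2p} H : ℚ(-p)]`**. [cite: CattaniElZeinGriffithsLe2014, Def. 3.2.15 and Ex. 3.2.23 (1)]
[cite: Beachy1999RingsModules, §2.5, Thm. 2.5.2] -/
theorem multiplicity_tate_eq_multiplicity_gr (p : ℤ) :
    H.multiplicity (HodgeStructure.tate (-p)).toMixedHodgeStructure =
      (H.gr (2 * p)).toMixedHodgeStructure.multiplicity (HodgeStructure.tate (-p)).toMixedHodgeStructure := by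
  have hpure : (HodgeStructure.tate (-p)).toMixedHodgeStructure.IsPure (2 * p) := by
    rw [show (2 : ℤ) * p = -2 * -p by ring]
    exact HodgeStructure.isPure_toMixedHodgeStructure (HodgeStructure.tate (-p))
  exact multiplicity_eq_multiplicity_gr H hpure

/-- For a graded-polarizable `H`: **`[H : ℚ(-p)] = dim_ℚ Hdgᵖ(Gr^W_{2p} H)`**, so `dim Hdgᵖ(H) ≤ dim Hdgᵖ(Gr^W_{2p} H)`
with defect `[H/soc H : ℚ(-p)]`. [cite: Jannsen1990MixedMotives, 7.8 b) and Thm. 7.9 (proof)] [cite: Arapura2022, §1 Lemma 1.1] -/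
theorem IsGradedPolarizable.multiplicity_tate_eq_finrank_hodgeClasses_gr (hp : H.IsGradedPolarizable) (p : ℤ) :
    H.multiplicity (HodgeStructure.tate (-p)).toMixedHodgeStructure =
      finrank ℚ ((H.gr (2 * p)).toMixedHodgeStructure.hodgeClasses p) := by
  rw [multiplicity_tate_eq_multiplicity_gr H p, (hp.isSemisimple_gr (2 * p)).finrank_hodgeClasses_eq_multiplicity p]

/-- For a graded-polarizable `H`: `dim Hdgᵖ(H) + [H/soc H : ℚ(-p)] = dim Hdgᵖ(Gr^W_{2p} H)`.
[cite: Jannsen1990MixedMotives, 7.8 (p. 94)] [cite: Arapura2022, §1 Lemma 1.1] -/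
theorem IsGradedPolarizable.finrank_hodgeClasses_add_multiplicity_quotient_socle (hp : H.IsGradedPolarizable) (p : ℤ) :
    finrank ℚ (H.hodgeClasses p) + (socle H).quotient.multiplicity (HodgeStructure.tate (-p)).toMixedHodgeStructure =
      finrank ℚ ((H.gr (2 * p)).toMixedHodgeStructure.hodgeClasses p) := by
  rw [← hp.multiplicity_tate_eq_finrank_hodgeClasses_gr p]
  exact MixedHodgeStructure.finrank_hodgeClasses_add_multiplicity_quotient_socle H p

omit [FiniteDimensional ℚ V] in
/-- Semisimple MHS with the same multiplicity of `ℚ(-p)` have the same number of Hodge classes of type `(p,p)`.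
[cite: Jannsen1990MixedMotives, 7.8 b) (p. 94)] -/
theorem IsSemisimple.finrank_hodgeClasses_eq_of_multiplicity_eq [FiniteDimensional ℚ V] {V' : Type*} [AddCommGroup V']
    [Module ℚ V'] [FiniteDimensional ℚ V'] {H' : MixedHodgeStructure V'} (hH : H.IsSemisimple) (hH' : H'.IsSemisimple)
    {p : ℤ} (h : H.multiplicity (HodgeStructure.tate (-p)).toMixedHodgeStructure =
      H'.multiplicity (HodgeStructure.tate (-p)).toMixedHodgeStructure) :
    finrank ℚ (H.hodgeClasses p) = finrank ℚ (H'.hodgeClasses p) := by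
  rw [hH.finrank_hodgeClasses_eq_multiplicity, hH'.finrank_hodgeClasses_eq_multiplicity, h]

end MixedHodgeStructure

end Literature.AlgebraicGeometry.Motives
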